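import Summits.ValiantsHypothesis.ValiantsHypothesis.Theorems.DivisionGapShadowBirkhoffPolytropeDefs

/-!
# Thurston's height dictionary, I: height functions ↦ domino tilings

Support file for item `stmt-ValiantsHypothesis-5069` (route `DivisionGap`, crux `ShadowBirkhoff`, line
`polytrope-kr-planar-dimers`, stub `stub_heightPolytrope`): the direction "integer point of the Lipschitz
polytrope `LIP_m` ↦ domino tiling of the `2m × 2m` board" of Thurston's bijection, in the conventions of
`DivisionGapShadowBirkhoffPolytropeDefs` (`heightPoints`, `VertOK`, `HorizOK`, `dominoPoints`).

For a reduced height `g` (extended by `0` outside the board, `extN`) the DOMINO INDICATOR across a lattice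
edge is affine in `g`:
* `vEdge g a b` — across the vertical lattice edge of column `a` between the lattice points `(a, b)` and
  `(a, b+1)`, i.e. between the cells `(a-1, b)` and `(a, b)`: `χ ∓ δ` with `δ = g(a,b+1) − g(a,b)`,
  `χ = [a odd]`, sign as in `VertOK`;
* `hEdge g a b` — across the horizontal lattice edge of row `b` between `(a, b)` and `(a+1, b)`, i.e.
  between the cells `(a, b-1)` and `(a, b)`: `∓ δ` with `δ = g(a+1,b) − g(a,b)`, sign as in `HorizOK`.

The four sides of every cell sum to `1` identically (`cell_height`, pure algebra); for `g ∈ heightPoints m`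
each side value is an integer in `{0, 1}` and the sides on the boundary of the board vanish, so every cell
has exactly one partner: `heightToDomino g ∈ dominoPoints (2m)` (`heightToDomino_mem`).  The map
`heightToDomino g (c, c') = XN g c.1 c.2 c'.1 c'.2` is the symmetric matrix of side values.

References: W. P. Thurston, *Conway's tiling groups*, Amer. Math. Monthly 97 (1990) 757–773; J. Propp,
*Lattice structure for orientations of graphs*, arXiv:math/0209005, Thm 2.  Only Mathlib and the Defs
file are used.
-/

set_option linter.dupNamespace false

noncomputable section

namespace Summit.ValiantsHypothesis.ValiantsHypothesis.Theorems.DivisionGapShadowBirkhoff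

variable {m : ℕ}

/-! ## Total extension of a lattice function -/

/-- Total extension of a function on the lattice points of the `2m × 2m` board to `ℕ × ℕ` (zero outside). -/
def extN (g : LatticePt m → ℝ) (a b : ℕ) : ℝ :=
  if h : a < 2 * m + 1 ∧ b < 2 * m + 1 then g (⟨a, h.1⟩, ⟨b, h.2⟩) else 0

/-- `extN` at an in-range point. -/
theorem extN_eq (g : LatticePt m → ℝ) {a b : ℕ} (ha : a < 2 * m + 1) (hb : b < 2 * m + 1) :
    extN g a b = g (⟨a, ha⟩, ⟨b, hb⟩) := by
  unfold extN
  rw [dif_pos ⟨ha, hb⟩]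

/-- Every value of `g` is a value of `extN g`. -/
theorem apply_eq_extN (g : LatticePt m → ℝ) (x y : Fin (2 * m + 1)) : g (x, y) = extN g x y := by
  rw [extN_eq g x.2 y.2]

/-- `extN g` vanishes on column `0` if `g` vanishes on the boundary. -/
theorem extN_col_zero {g : LatticePt m → ℝ} (hg0 : ∀ p, IsBoundaryPt m p → g p = 0) (b : ℕ) :
    extN g 0 b = 0 := by
  unfold extN
  split_ifs with h
  · exact hg0 _ (Or.inl rfl)
  · rfl

/-- `extN g` vanishes on column `2m` if `g` vanishes on the boundary. -/
theorem extN_col_top {g : LatticePt m → ℝ} (hg0 : ∀ p, IsBoundaryPt m p → g p = 0) (b : ℕ) :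
    extN g (2 * m) b = 0 := by
  unfold extN
  split_ifs with h
  · exact hg0 _ (Or.inr (Or.inl rfl))
  · rfl

/-- `extN g` vanishes on row `0` if `g` vanishes on the boundary. -/
theorem extN_row_zero {g : LatticePt m → ℝ} (hg0 : ∀ p, IsBoundaryPt m p → g p = 0) (a : ℕ) :
    extN g a 0 = 0 := by
  unfold extN
  split_ifs with h
  · exact hg0 _ (Or.inr (Or.inr (Or.inl rfl)))
  · rfl

/-- `extN g` vanishes on row `2m` if `g` vanishes on the boundary. -/
theorem extN_row_top {g : LatticePt m → ℝ} (hg0 : ∀ p, IsBoundaryPt m p → g p = 0) (a : ℕ) :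
    extN g a (2 * m) = 0 := by
  unfold extN
  split_ifs with h
  · exact hg0 _ (Or.inr (Or.inr (Or.inr rfl)))
  · rfl

/-- `extN g` is integer-valued if `g` is. -/
theorem extN_int {g : LatticePt m → ℝ} (hgi : ∀ p, ∃ z : ℤ, g p = z) (a b : ℕ) :
    ∃ z : ℤ, extN g a b = z := by
  unfold extN
  split_ifs with h
  · exact hgi _
  · exact ⟨0, by simp⟩

/-- An integer-valued real in `[0, 1]` is `0` or `1`. -/
theorem int01 {t : ℝ} (ht : ∃ z : ℤ, t = z) (h0 : 0 ≤ t) (h1 : t ≤ 1) : t = 0 ∨ t = 1 := by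
  obtain ⟨z, rfl⟩ := ht
  have h0' : (0 : ℤ) ≤ z := by exact_mod_cast h0
  have h1' : z ≤ 1 := by exact_mod_cast h1
  rcases (show z = 0 ∨ z = 1 by omega) with rfl | rfl <;> simp

/-! ## Side values (domino indicators across lattice edges), affine in the height -/

/-- Indicator across the vertical lattice edge of column `a` between `(a, b)` and `(a, b+1)` (cells
`(a-1, b)` | `(a, b)`): `χ − δ` if `a + b` is odd, `χ + δ` otherwise, `δ = g(a,b+1) − g(a,b)`, `χ = [a odd]`. -/
def vEdge (g : LatticePt m → ℝ) (a b : ℕ) : ℝ :=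
  if (a + b) % 2 = 1 then (if a % 2 = 1 then (1 : ℝ) else 0) - (extN g a (b + 1) - extN g a b)
  else (if a % 2 = 1 then (1 : ℝ) else 0) + (extN g a (b + 1) - extN g a b)

/-- Indicator across the horizontal lattice edge of row `b` between `(a, b)` and `(a+1, b)` (cells
`(a, b-1)` / `(a, b)`): `−δ` if `a + b` is even, `δ` otherwise, `δ = g(a+1,b) − g(a,b)`. -/
def hEdge (g : LatticePt m → ℝ) (a b : ℕ) : ℝ :=
  if (a + b) % 2 = 0 then -(extN g (a + 1) b - extN g a b) else extN g (a + 1) b - extN g a b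

/-- THE CELL IDENTITY: the four side values of the cell `(i, j)` (left, right, bottom, top) sum to `1`,
for every real function `g`. -/
theorem cell_height (g : LatticePt m → ℝ) (i j : ℕ) :
    vEdge g i j + vEdge g (i + 1) j + hEdge g i j + hEdge g i (j + 1) = 1 := by
  unfold vEdge hEdge
  split_ifs <;> first | (exfalso; omega) | ring

/-- For a height function, a vertical-edge side value lies in `[0, 1]` (this is `VertOK`). -/
theorem vEdge_bounds {g : LatticePt m → ℝ} (hV : ∀ a b, VertOK m g a b) {a b : ℕ}
    (ha : a < 2 * m + 1) (hb : b < 2 * m) : 0 ≤ vEdge g a b ∧ vEdge g a b ≤ 1 := by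
  have h := hV ⟨a, ha⟩ ⟨b, hb⟩
  simp only [VertOK, Fin.succ_mk, Fin.castSucc_mk, apply_eq_extN] at h
  unfold vEdge
  split_ifs at h ⊢ <;> constructor <;> linarith [h.1, h.2]

/-- For a height function, a horizontal-edge side value lies in `[0, 1]` (this is `HorizOK`). -/
theorem hEdge_bounds {g : LatticePt m → ℝ} (hH : ∀ a b, HorizOK m g a b) {a b : ℕ}
    (ha : a < 2 * m) (hb : b < 2 * m + 1) : 0 ≤ hEdge g a b ∧ hEdge g a b ≤ 1 := by
  have h := hH ⟨a, ha⟩ ⟨b, hb⟩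
  simp only [HorizOK, Fin.succ_mk, Fin.castSucc_mk, apply_eq_extN] at h
  unfold hEdge
  split_ifs at h ⊢ <;> constructor <;> linarith [h.1, h.2]

/-- Vertical-edge side values of an integer-valued `g` are integers. -/
theorem vEdge_int {g : LatticePt m → ℝ} (hgi : ∀ p, ∃ z : ℤ, g p = z) (a b : ℕ) :
    ∃ z : ℤ, vEdge g a b = z := by
  obtain ⟨z1, h1⟩ := extN_int hgi a (b + 1)
  obtain ⟨z2, h2⟩ := extN_int hgi a b
  unfold vEdge
  rw [h1, h2]
  split_ifs
  · exact ⟨1 - (z1 - z2), by push_cast; ring⟩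
  · exact ⟨0 - (z1 - z2), by push_cast; ring⟩
  · exact ⟨1 + (z1 - z2), by push_cast; ring⟩
  · exact ⟨0 + (z1 - z2), by push_cast; ring⟩

/-- Horizontal-edge side values of an integer-valued `g` are integers. -/
theorem hEdge_int {g : LatticePt m → ℝ} (hgi : ∀ p, ∃ z : ℤ, g p = z) (a b : ℕ) :
    ∃ z : ℤ, hEdge g a b = z := by
  obtain ⟨z1, h1⟩ := extN_int hgi (a + 1) b
  obtain ⟨z2, h2⟩ := extN_int hgi a b
  unfold hEdge
  rw [h1, h2]
  split_ifs
  · exact ⟨-(z1 - z2), by push_cast; ring⟩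
  · exact ⟨z1 - z2, by push_cast; ring⟩

/-- For a height function, every vertical-edge side value inside the board is `0` or `1`. -/
theorem vEdge_01 {g : LatticePt m → ℝ} (hg : g ∈ heightPoints m) {a b : ℕ}
    (ha : a < 2 * m + 1) (hb : b < 2 * m) : vEdge g a b = 0 ∨ vEdge g a b = 1 :=
  int01 (vEdge_int hg.1 a b) (vEdge_bounds hg.2.2.1 ha hb).1 (vEdge_bounds hg.2.2.1 ha hb).2

/-- For a height function, every horizontal-edge side value inside the board is `0` or `1`. -/
theorem hEdge_01 {g : LatticePt m → ℝ} (hg : g ∈ heightPoints m) {a b : ℕ}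
    (ha : a < 2 * m) (hb : b < 2 * m + 1) : hEdge g a b = 0 ∨ hEdge g a b = 1 :=
  int01 (hEdge_int hg.1 a b) (hEdge_bounds hg.2.2.2 ha hb).1 (hEdge_bounds hg.2.2.2 ha hb).2

/-- The left side of a cell in column `0` is not crossed. -/
theorem vEdge_col_zero {g : LatticePt m → ℝ} (hg0 : ∀ p, IsBoundaryPt m p → g p = 0) (b : ℕ) :
    vEdge g 0 b = 0 := by
  unfold vEdge
  rw [extN_col_zero hg0, extN_col_zero hg0]
  split_ifs <;> first | (exfalso; omega) | simp

/-- The right side of a cell in column `2m - 1` is not crossed. -/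
theorem vEdge_col_top {g : LatticePt m → ℝ} (hg0 : ∀ p, IsBoundaryPt m p → g p = 0) (b : ℕ) :
    vEdge g (2 * m) b = 0 := by
  unfold vEdge
  rw [extN_col_top hg0, extN_col_top hg0]
  split_ifs <;> first | (exfalso; omega) | simp

/-- The bottom side of a cell in row `0` is not crossed. -/
theorem hEdge_row_zero {g : LatticePt m → ℝ} (hg0 : ∀ p, IsBoundaryPt m p → g p = 0) (a : ℕ) :
    hEdge g a 0 = 0 := by
  unfold hEdge
  rw [extN_row_zero hg0, extN_row_zero hg0]
  split_ifs <;> simp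

/-- The top side of a cell in row `2m - 1` is not crossed. -/
theorem hEdge_row_top {g : LatticePt m → ℝ} (hg0 : ∀ p, IsBoundaryPt m p → g p = 0) (a : ℕ) :
    hEdge g a (2 * m) = 0 := by
  unfold hEdge
  rw [extN_row_top hg0, extN_row_top hg0]
  split_ifs <;> simp

/-! ## The dictionary `heightToDomino` -/

/-- Side value of the cell `(i, j)` towards `(i', j')` (right, left, top, bottom neighbour), `0` for
non-neighbours. -/
def XN (g : LatticePt m → ℝ) (i j i' j' : ℕ) : ℝ :=
  if i + 1 = i' ∧ j = j' then vEdge g (i + 1) j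
  else if i' + 1 = i ∧ j = j' then vEdge g i j
  else if i = i' ∧ j + 1 = j' then hEdge g i (j + 1)
  else if i = i' ∧ j' + 1 = j then hEdge g i j
  else 0

/-- Thurston's dictionary, heights ↦ points of the domino space `ℝ^{V × V}`, `V = Fin 2m × Fin 2m`:
the (affine in `g`) matrix of side values. -/
def heightToDomino (g : LatticePt m → ℝ) :
    (Fin (2 * m) × Fin (2 * m)) × (Fin (2 * m) × Fin (2 * m)) → ℝ :=
  fun e => XN g e.1.1 e.1.2 e.2.1 e.2.2

/-- The side-value matrix is symmetric. -/
theorem XN_symm (g : LatticePt m → ℝ) (i j i' j' : ℕ) : XN g i j i' j' = XN g i' j' i j := by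
  unfold XN
  by_cases hA : i + 1 = i' ∧ j = j'
  · obtain ⟨rfl, rfl⟩ := hA
    rw [if_pos ⟨rfl, rfl⟩, if_neg (show ¬(i + 1 + 1 = i ∧ j = j) by omega), if_pos ⟨rfl, rfl⟩]
  rw [if_neg hA]
  by_cases hB : i' + 1 = i ∧ j = j'
  · obtain ⟨rfl, rfl⟩ := hB
    rw [if_pos ⟨rfl, rfl⟩, if_pos ⟨rfl, rfl⟩]
  rw [if_neg hB]
  by_cases hC : i = i' ∧ j + 1 = j'
  · obtain ⟨rfl, rfl⟩ := hC
    rw [if_pos ⟨rfl, rfl⟩, if_neg (show ¬(i + 1 = i ∧ j + 1 = j) by omega),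
      if_neg (show ¬(i + 1 = i ∧ j + 1 = j) by omega),
      if_neg (show ¬(i = i ∧ j + 1 + 1 = j) by omega), if_pos ⟨rfl, rfl⟩]
  rw [if_neg hC]
  by_cases hD : i = i' ∧ j' + 1 = j
  · obtain ⟨rfl, rfl⟩ := hD
    rw [if_pos ⟨rfl, rfl⟩, if_neg (show ¬(i + 1 = i ∧ j' = j' + 1) by omega),
      if_neg (show ¬(i + 1 = i ∧ j' = j' + 1) by omega), if_pos ⟨rfl, rfl⟩]
  rw [if_neg hD, if_neg (fun h => hB ⟨h.1, h.2.symm⟩), if_neg (fun h => hA ⟨h.1, h.2.symm⟩),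
    if_neg (fun h => hD ⟨h.1.symm, h.2⟩), if_neg (fun h => hC ⟨h.1.symm, h.2⟩)]

/-- `heightToDomino g` is a symmetric matrix. -/
theorem heightToDomino_symm (g : LatticePt m → ℝ) (c c' : Fin (2 * m) × Fin (2 * m)) :
    heightToDomino g (c, c') = heightToDomino g (c', c) :=
  XN_symm g _ _ _ _

/-- For a height function every entry of the side-value matrix (at a cell of the board) is `0` or `1`. -/
theorem XN_01 {g : LatticePt m → ℝ} (hg : g ∈ heightPoints m) {i j : ℕ} (hi : i < 2 * m)
    (hj : j < 2 * m) (i' j' : ℕ) : XN g i j i' j' = 0 ∨ XN g i j i' j' = 1 := by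
  unfold XN
  split_ifs
  · exact vEdge_01 hg (by omega) hj
  · exact vEdge_01 hg (by omega) hj
  · exact hEdge_01 hg hi (by omega)
  · exact hEdge_01 hg hi (by omega)
  · exact Or.inl rfl

/-- For a height function every cell has at most one partner. -/
theorem XN_unique {g : LatticePt m → ℝ} (hg : g ∈ heightPoints m) {i j : ℕ} (hi : i < 2 * m)
    (hj : j < 2 * m) {i' j' i'' j'' : ℕ} (h1 : XN g i j i' j' = 1) (h2 : XN g i j i'' j'' = 1) :
    i' = i'' ∧ j' = j'' := by
  have hc := cell_height g i j
  have b1 := vEdge_bounds hg.2.2.1 (a := i) (b := j) (by omega) hj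
  have b2 := vEdge_bounds hg.2.2.1 (a := i + 1) (b := j) (by omega) hj
  have b3 := hEdge_bounds hg.2.2.2 (a := i) (b := j) hi (by omega)
  have b4 := hEdge_bounds hg.2.2.2 (a := i) (b := j + 1) hi (by omega)
  unfold XN at h1 h2
  split_ifs at h1 h2 <;>
    first | omega | (exfalso; linarith [b1.1, b2.1, b3.1, b4.1])

/-- For a height function every cell has a partner inside the board. -/
theorem XN_exists {g : LatticePt m → ℝ} (hg : g ∈ heightPoints m) {i j : ℕ} (hi : i < 2 * m)
    (hj : j < 2 * m) : ∃ i' j', i' < 2 * m ∧ j' < 2 * m ∧ XN g i j i' j' = 1 := by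
  have hc := cell_height g i j
  have hg0 := hg.2.1
  rcases vEdge_01 hg (a := i + 1) (b := j) (by omega) hj with hR | hR
  · rcases vEdge_01 hg (a := i) (b := j) (by omega) hj with hL | hL
    · rcases hEdge_01 hg (a := i) (b := j + 1) hi (by omega) with hT | hT
      · -- the bottom side is crossed
        have hB : hEdge g i j = 1 := by linarith
        obtain ⟨j₀, rfl⟩ : ∃ j₀, j = j₀ + 1 := by
          rcases Nat.eq_zero_or_eq_succ_pred j with h0 | h0
          · rw [h0, hEdge_row_zero hg0] at hB
            exact absurd hB (by norm_num)
          · exact ⟨_, h0⟩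
        refine ⟨i, j₀, hi, by omega, ?_⟩
        unfold XN
        rw [if_neg (show ¬(i + 1 = i ∧ j₀ + 1 = j₀) by omega),
          if_neg (show ¬(i + 1 = i ∧ j₀ + 1 = j₀) by omega),
          if_neg (show ¬(i = i ∧ j₀ + 1 + 1 = j₀) by omega), if_pos ⟨rfl, rfl⟩]
        exact hB
      · -- the top side is crossed
        have hj' : j + 1 < 2 * m := by
          rcases Nat.lt_or_ge (j + 1) (2 * m) with h0 | h0
          · exact h0
          · rw [show j + 1 = 2 * m by omega, hEdge_row_top hg0] at hT
            exact absurd hT (by norm_num)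
        refine ⟨i, j + 1, hi, hj', ?_⟩
        unfold XN
        rw [if_neg (show ¬(i + 1 = i ∧ j = j + 1) by omega),
          if_neg (show ¬(i + 1 = i ∧ j = j + 1) by omega), if_pos ⟨rfl, rfl⟩]
        exact hT
    · -- the left side is crossed
      obtain ⟨i₀, rfl⟩ : ∃ i₀, i = i₀ + 1 := by
        rcases Nat.eq_zero_or_eq_succ_pred i with h0 | h0
        · rw [h0, vEdge_col_zero hg0] at hL
          exact absurd hL (by norm_num)
        · exact ⟨_, h0⟩
      refine ⟨i₀, j, by omega, hj, ?_⟩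
      unfold XN
      rw [if_neg (show ¬(i₀ + 1 + 1 = i₀ ∧ j = j) by omega), if_pos ⟨rfl, rfl⟩]
      exact hL
  · -- the right side is crossed
    have hi' : i + 1 < 2 * m := by
      rcases Nat.lt_or_ge (i + 1) (2 * m) with h0 | h0
      · exact h0
      · rw [show i + 1 = 2 * m by omega, vEdge_col_top hg0] at hR
        exact absurd hR (by norm_num)
    refine ⟨i + 1, j, hi', hj, ?_⟩
    unfold XN
    rw [if_pos ⟨rfl, rfl⟩]
    exact hR

/-- THURSTON'S DICTIONARY, first half: the side-value matrix of a height function of the `2m × 2m`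
board is (the indicator of) a domino tiling, i.e. a point of `dominoPoints (2m)`. -/
theorem heightToDomino_mem {m : ℕ} {g : LatticePt m → ℝ} (hg : g ∈ heightPoints m) :
    heightToDomino g ∈ dominoPoints (2 * m) := by
  have hex : ∀ c : Fin (2 * m) × Fin (2 * m), ∃ c' : Fin (2 * m) × Fin (2 * m),
      heightToDomino g (c, c') = 1 := by
    intro c
    obtain ⟨i', j', hi', hj', h⟩ := XN_exists hg c.1.2 c.2.2
    exact ⟨(⟨i', hi'⟩, ⟨j', hj'⟩), h⟩
  choose f hf using hex
  have huniq : ∀ c c' c'' : Fin (2 * m) × Fin (2 * m), heightToDomino g (c, c') = 1 →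
      heightToDomino g (c, c'') = 1 → c' = c'' := by
    intro c c' c'' h1 h2
    obtain ⟨h3, h4⟩ := XN_unique hg c.1.2 c.2.2 h1 h2
    exact Prod.ext (Fin.ext h3) (Fin.ext h4)
  refine ⟨f, fun c => ⟨?_, ?_, ?_⟩, ?_⟩
  · have h1 : heightToDomino g (f c, c) = 1 := by rw [heightToDomino_symm]; exact hf c
    exact huniq (f c) (f (f c)) c (hf (f c)) h1
  · intro h
    have h1 := hf c
    rw [h] at h1
    unfold heightToDomino XN at h1
    dsimp only at h1
    rw [if_neg (by omega), if_neg (by omega), if_neg (by omega), if_neg (by omega)] at h1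
    exact absurd h1 (by norm_num)
  · have h := hf c
    revert h
    unfold heightToDomino XN IsGridAdjacent
    dsimp only
    split_ifs with h1 h2 h3 h4 <;> intro h
    · exact Or.inl ⟨h1.1, Fin.ext h1.2⟩
    · exact Or.inr (Or.inl ⟨h2.1, Fin.ext h2.2⟩)
    · exact Or.inr (Or.inr (Or.inl ⟨Fin.ext h3.1, h3.2⟩))
    · exact Or.inr (Or.inr (Or.inr ⟨Fin.ext h4.1, h4.2⟩))
    · exact absurd h (by norm_num)
  · funext e
    by_cases h : f e.1 = e.2
    · rw [if_pos h]
      have h1 := hf e.1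
      rwa [h, Prod.mk.eta] at h1
    · rw [if_neg h]
      rcases XN_01 hg e.1.1.2 e.1.2.2 e.2.1 e.2.2 with h0 | h1
      · exact h0
      · exact absurd (huniq e.1 (f e.1) e.2 (hf e.1) h1) h

end Summit.ValiantsHypothesis.ValiantsHypothesis.Theorems.DivisionGapShadowBirkhoff

end
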